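import Summits.BirchSwinnertonDyer.BirchSwinnertonDyer.Theses.CongruentShaFreeCut
import Literature.NumberTheory.EllipticCurves.BSDWave0ContinuationProofs
import Literature.NumberTheory.EllipticCurves.BSDInvariantsProofs
import Literature.NumberTheory.EllipticCurves.SelmerCorankIsogenyProofs
import Literature.NumberTheory.EllipticCurves.IsogenyVariableChangeProofs

/-! # Route `CongruentShaFreeCut` (rung S2) — crux `RankPosOfTwoSelmerCorankOne`
(stmt-BirchSwinnertonDyer-19079, the route's declared RESIDUAL conjunct): reduction to square-free `n`

Crux A = `∀ n ≠ 0, corank_{ℤ₂} Sel_{2^∞}(E_n/ℚ) = 1 ⟹ rank E_n(ℚ) ≥ 1`, `E_n : y² = x³ − n²x`. Writing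
`n = b²a` with `a` square-free (`Nat.sq_mul_squarefree_of_pos`), `E_n = C • E_a` is an admissible change
of variables of `E_a` over `ℚ` (tree lemma `congruentNumberCurve_sq_mul`, Koblitz Ch. I §2), hence
`ℚ`-isogenous to it (`isIsogenous_of_smul`); the `2^∞`-Selmer corank is an isogeny invariant
(`IsIsogenous.selmerCorank_eq`, Greenberg LNM 1716 §1) and the Mordell–Weil rank is invariant under
changes of variables (`mordellWeilRank_variableChange_holds`, Silverman AEC III.3.1(b)). So crux A is
EQUIVALENT to its square-free case (`rankPosOfTwoSelmerCorankOne_iff_squarefree`) — the form every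
`K`-level line consumes (global minimality of `E_n`, `isGloballyMinimal_congruentNumberCurve`, holds
exactly for square-free `n`), the crux-A twin of
`…Theorems.CongruentShaFreeCutSquarefreeReduction.analyticRankOneOfRankOneFiniteShaTwo_iff_squarefree`
(crux B, p417672). Tree theorems only; supports, does not close, stmt-BirchSwinnertonDyer-19079. -/

namespace Summit.BirchSwinnertonDyer.BirchSwinnertonDyer.Theorems.CongruentShaFreeCutRankPosSquarefreeReduction

open Literature.NumberTheory.EllipticCurves WeierstrassCurve
open Summit.BirchSwinnertonDyer.BirchSwinnertonDyer.Theses.CongruentShaFreeCut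

/-- **`corank_{ℤ_p} Sel_{p^∞}(E_{b²a}) = corank_{ℤ_p} Sel_{p^∞}(E_a)`** (`a, b ≠ 0`): `E_{b²a} = C • E_a`
(`congruentNumberCurve_sq_mul`) is `ℚ`-isogenous to `E_a` (`isIsogenous_of_smul`), and the Selmer
corank is an isogeny invariant (`IsIsogenous.selmerCorank_eq`). [cite: Greenberg1999LNM, §1 pp. 54–57] -/
theorem selmerCorank_congruentNumberCurve_sq_mul {a b : ℕ} (ha : a ≠ 0) (hb : b ≠ 0) (p : ℕ)
    [Fact p.Prime] :
    (congruentNumberCurve (b ^ 2 * a)).selmerCorank p = (congruentNumberCurve a).selmerCorank p := by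
  haveI := isElliptic_congruentNumberCurve ha
  haveI := isElliptic_congruentNumberCurve (mul_ne_zero (pow_ne_zero 2 hb) ha)
  have hiso : IsIsogenous (congruentNumberCurve (b ^ 2 * a)) (congruentNumberCurve a) := by
    rw [congruentNumberCurve_sq_mul a hb]
    exact isIsogenous_of_smul _ _
  exact hiso.selmerCorank_eq p

/-- **`rank E_{b²a}(ℚ) = rank E_a(ℚ)`** (`b ≠ 0`): the Mordell–Weil rank is invariant under the
change of variables `E_{b²a} = C • E_a`. [cite: SilvermanAEC2009, III.3.1(b)] -/
theorem mordellWeilRank_congruentNumberCurve_sq_mul (a : ℕ) {b : ℕ} (hb : b ≠ 0) :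
    (congruentNumberCurve (b ^ 2 * a)).mordellWeilRank = (congruentNumberCurve a).mordellWeilRank := by
  rw [congruentNumberCurve_sq_mul a hb]
  exact mordellWeilRank_variableChange_holds _ _

/-- **Crux A reduces to square-free `n`.** If `corank_{ℤ₂} Sel_{2^∞}(E_n/ℚ) = 1 ⟹ rank E_n(ℚ) ≥ 1`
holds for every SQUARE-FREE `n`, it holds for every `n ≠ 0` (write `n = b²a`; corank and rank agree on
`E_n` and `E_a`). [folklore] -/
theorem rankPosOfTwoSelmerCorankOne_of_squarefree
    (h : ∀ ⦃n : ℕ⦄, Squarefree n → (congruentNumberCurve n).selmerCorank 2 = 1 →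
      1 ≤ (congruentNumberCurve n).mordellWeilRank) :
    RankPosOfTwoSelmerCorankOne := by
  intro n hn hc
  obtain ⟨a, b, ha, hb, rfl, hsq⟩ := Nat.sq_mul_squarefree_of_pos (Nat.pos_of_ne_zero hn)
  haveI : Fact (Nat.Prime 2) := ⟨Nat.prime_two⟩
  rw [selmerCorank_congruentNumberCurve_sq_mul ha.ne' hb.ne' 2] at hc
  rw [mordellWeilRank_congruentNumberCurve_sq_mul a hb.ne']
  exact h hsq hc

/-- **Crux A is EQUIVALENT to its square-free case** (the converse direction is the specialisation
`Squarefree n ⟹ n ≠ 0`). [folklore] -/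
theorem rankPosOfTwoSelmerCorankOne_iff_squarefree :
    RankPosOfTwoSelmerCorankOne ↔
      ∀ ⦃n : ℕ⦄, Squarefree n → (congruentNumberCurve n).selmerCorank 2 = 1 →
        1 ≤ (congruentNumberCurve n).mordellWeilRank :=
  ⟨fun h _ hsq => h hsq.ne_zero, rankPosOfTwoSelmerCorankOne_of_squarefree⟩

end Summit.BirchSwinnertonDyer.BirchSwinnertonDyer.Theorems.CongruentShaFreeCutRankPosSquarefreeReduction
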